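import Summits.CriticalPhenomena.PercolationContinuityZ3.Theses.PercTorusSliceFilling
import Literature.Probability.Percolation.BondPercolationSymmetry
import Literature.Probability.Percolation.SlabCriticalityInputs
import Literature.Probability.LatticeModels.IsingTransport
import HarnessLib

/-!
# Crux `PercTorusSliceFilling.TorusNonProliferation` (stmt-CriticalPhenomena-5415), line `registered` (`birth`) — stub `stub_sfVolumeMean`

Helper file for the crux skeleton `Cruxes/TorusNonProliferation/Lines/birth.lean`
(lead prover-line-stmt-CriticalPhenomena-5415). Proves exactly the registered stub signature
`stub_sfVolumeMean`; lands with `--supports stmt-CriticalPhenomena-5415`.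

## The statement (first moment of the total slice-filling volume on the torus)

On the discrete torus `T_n = (ℤ/nℤ)³` (`torusGraph 3 n`, `n ≥ 1`) call a set of sites `S`
*slice-filling* (sf) if in some direction `i` it meets every slice `{y | y i = t}`, `t : ZMod n`.
For Bernoulli bond percolation `P_{T_n,p}` at ANY density `p`, the total slice-filling volume
`V_sf(ω) = #{x : C_ω(x) sf}` has mean
`E_{T_n,p}[V_sf] = n³ · P_{T_n,p}(C(0) sf)`.

## The argument (transitivity of the torus measure)

* `V_sf = Σ_x 1{C(x) sf}` over the finite vertex set, so by linearity
  `E V_sf = Σ_x P(C(x) sf)` (`integral_ncard_setOf_eq_sum`; every event of the finite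
  configuration space `Set (Sym2 T_n)` is measurable).
* For every `x`, the translation `y ↦ y + x` is an automorphism of `torusGraph 3 n`
  (`torusGraph_adj_add_right`, IsingTransport.lean), `bondPercolation` is invariant under the
  induced relabelling of configurations (`bondPercolation_real_preimage_relabel_iso`,
  BondPercolationSymmetry.lean), open clusters are transported (`C_{ω + x}(x) = C_ω(0) + x`,
  `openCluster_relabel`, SlabCriticalityInputs.lean) and slice-filling is invariant under
  translation (`t ↦ t - x i` permutes `ZMod n`, `sliceFilling_image_add_iff`); hence
  `P(C(x) sf) = P(C(0) sf)` (`measureReal_sliceFilling_eq_zero`).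
* `#T_n = n³` (`ZMod.card`).

No named facts are used. Tree API: `bondPercolation_real_preimage_relabel_iso`,
`BondConfig.relabel`, `sym2Equiv` (BondPercolationSymmetry.lean), `openCluster_relabel`
(SlabCriticalityInputs.lean), `torusGraph_adj_add_right` (IsingTransport.lean). Mathlib API:
`integral_finsetSum`, `integral_indicator_one`, `Finset.natCast_card_filter`, `ZMod.card`.
-/

noncomputable section

namespace Summit.CriticalPhenomena.PercolationContinuityZ3.Theorems.PercTorusSliceFillingTorusNonProliferation

open MeasureTheory Set
open Literature.Probability.Percolation Literature.Probability.LatticeModels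

/-! ### Counting: the integral of a random cardinality is a sum of probabilities -/

/-- **Linearity of expectation for a random finite set.** On a finite-measure space, for events
`{ω | P ω x}` indexed by a finite type, `∫ #{x | P ω x} dμ = Σ_x μ {ω | P ω x}`
(`#{x | P ω x} = Σ_x 1{P ω x}` pointwise, then `integral_finsetSum` and
`integral_indicator_one`). -/
theorem integral_ncard_setOf_eq_sum {Ω V : Type*} [MeasurableSpace Ω] [Fintype V]
    (μ : Measure Ω) [IsFiniteMeasure μ] (P : Ω → V → Prop)
    (hP : ∀ x, MeasurableSet {ω | P ω x}) :
    ∫ ω, (Set.ncard {x | P ω x} : ℝ) ∂μ = ∑ x, μ.real {ω | P ω x} := by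
  classical
  have h1 : ∀ ω, (Set.ncard {x | P ω x} : ℝ) =
      ∑ x, ({ω' | P ω' x} : Set Ω).indicator (1 : Ω → ℝ) ω := by
    intro ω
    have hset : {x | P ω x} = ↑(Finset.univ.filter fun x => P ω x) := by
      ext x
      simp
    rw [hset, Set.ncard_coe_finset, Finset.natCast_card_filter]
    refine Finset.sum_congr rfl fun x _ => ?_
    by_cases hx : P ω x <;> simp [hx]
  simp_rw [h1]
  have hint : ∀ x ∈ (Finset.univ : Finset V),
      Integrable (fun ω => ({ω' | P ω' x} : Set Ω).indicator (1 : Ω → ℝ) ω) μ :=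
    fun x _ => (integrable_const (1 : ℝ)).indicator (hP x)
  rw [integral_finsetSum _ hint]
  exact Finset.sum_congr rfl fun x _ => integral_indicator_one (hP x)

/-! ### The torus: translations and slice-filling -/

/-- Slice-filling is translation invariant: `S + a` meets every slice `{y i = t}` in some
direction `i` iff `S` does (`t ↦ t - a i` permutes `ZMod L`). -/
theorem sliceFilling_image_add_iff {d L : ℕ} (a : TorusSite d L) (S : Set (TorusSite d L)) :
    (∃ i : Fin d, ∀ t : ZMod L, ∃ y ∈ (fun y => y + a) '' S, y i = t) ↔
      ∃ i : Fin d, ∀ t : ZMod L, ∃ y ∈ S, y i = t := by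
  refine exists_congr fun i => ⟨fun h t => ?_, fun h t => ?_⟩
  · obtain ⟨_, ⟨y, hy, rfl⟩, hyt⟩ := h (t + a i)
    exact ⟨y, hy, by simpa using hyt⟩
  · obtain ⟨y, hy, hyt⟩ := h (t - a i)
    exact ⟨y + a, Set.mem_image_of_mem _ hy, by rw [Pi.add_apply, hyt, sub_add_cancel]⟩

/-- The slice-filling event of the cluster of `x` pulls back, under relabelling by the
translation `y ↦ y + x`, to the slice-filling event of the cluster of the origin. -/
theorem preimage_relabel_addRight_sliceFilling (n : ℕ) (x : TorusSite 3 n) :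
    BondConfig.relabel (sym2Equiv (Equiv.addRight x)) ⁻¹'
        {ω | ∃ i : Fin 3, ∀ t : ZMod n, ∃ y ∈ openCluster ω x, y i = t} =
      {ω | ∃ i : Fin 3, ∀ t : ZMod n, ∃ y ∈ openCluster ω (0 : TorusSite 3 n), y i = t} := by
  ext ω
  simp only [Set.mem_preimage, Set.mem_setOf_eq]
  have h := openCluster_relabel (Equiv.addRight x) ω 0
  simp only [Equiv.coe_addRight, zero_add] at h
  rw [h]
  exact sliceFilling_image_add_iff x _

/-- **Transitivity of the torus measure on the slice-filling event**: for every `p`, `n` and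
`x ∈ T_n`, `P_{T_n,p}(C(x) sf) = P_{T_n,p}(C(0) sf)` (invariance of `bondPercolation` under the
graph automorphism `y ↦ y + x`, `bondPercolation_real_preimage_relabel_iso`). -/
theorem measureReal_sliceFilling_eq_zero (p : unitInterval) (n : ℕ) (x : TorusSite 3 n) :
    (bondPercolation (torusGraph 3 n) p).real
        {ω | ∃ i : Fin 3, ∀ t : ZMod n, ∃ y ∈ openCluster ω x, y i = t} =
      (bondPercolation (torusGraph 3 n) p).real
        {ω | ∃ i : Fin 3, ∀ t : ZMod n, ∃ y ∈ openCluster ω (0 : TorusSite 3 n), y i = t} := by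
  rw [← preimage_relabel_addRight_sliceFilling n x]
  exact (bondPercolation_real_preimage_relabel_iso (G := torusGraph 3 n) (G' := torusGraph 3 n)
    { toEquiv := Equiv.addRight x, map_rel_iff' := fun {a b} => torusGraph_adj_add_right x a b }
    p _).symm

/-! ### The stub -/

/-- **stub_sfVolumeMean (first moment of the total slice-filling volume; torus transitivity).**
For every `p` and every `n ≥ 1`, `E_{T_n,p}[#{x : C(x) slice-filling}] = n³ · P_{T_n,p}(C(0)
slice-filling)`: `#{x : C(x) sf} = Σ_x 1{C(x) sf}` (finite vertex set), linearity of the integral,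
`P(C(x) sf) = P(C(0) sf)` for every `x` by translation invariance of `bondPercolation` on the
torus (`measureReal_sliceFilling_eq_zero`), and `#T_n = n³`. Exactly the registered stub
signature of the line `birth` of crux `TorusNonProliferation`. -/
theorem stub_sfVolumeMean :
    ∀ (p : unitInterval) (n : ℕ), 1 ≤ n →
      ∫ ω, (Set.ncard {x : TorusSite 3 n |
          ∃ i : Fin 3, ∀ t : ZMod n, ∃ y ∈ openCluster ω x, y i = t} : ℝ)
        ∂(bondPercolation (torusGraph 3 n) p) =
      (n : ℝ) ^ 3 * (bondPercolation (torusGraph 3 n) p).real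
        {ω | ∃ i : Fin 3, ∀ t : ZMod n, ∃ y ∈ openCluster ω (0 : TorusSite 3 n), y i = t} := by
  classical
  intro p n hn
  haveI : NeZero n := ⟨by omega⟩
  have hcard : Fintype.card (TorusSite 3 n) = n ^ 3 := by
    simp [ZMod.card, Finset.prod_const]
  refine (integral_ncard_setOf_eq_sum (bondPercolation (torusGraph 3 n) p)
    (fun ω (x : TorusSite 3 n) => ∃ i : Fin 3, ∀ t : ZMod n, ∃ y ∈ openCluster ω x, y i = t)
    fun _ => MeasurableSet.of_discrete).trans ?_
  rw [Finset.sum_congr rfl fun x _ => measureReal_sliceFilling_eq_zero p n x, Finset.sum_const,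
    Finset.card_univ, nsmul_eq_mul, hcard]
  push_cast
  rfl

end Summit.CriticalPhenomena.PercolationContinuityZ3.Theorems.PercTorusSliceFillingTorusNonProliferation

end
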